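import Literature.MathematicalPhysics.QuantumLattice.GrassmannKernelsPresented
import Literature.MathematicalPhysics.QuantumLattice.HubbardScaleReport

/-!
# The leg-weighted `L¹–L^∞` norm of the kernel of a presented polynomial is at most that of its presentation
# (crux `SeededBrokenRegimeBoseFermiPinned` = stmt-HubbardSuperconductivity-14047, route AposterioriCapRg; supports, lead c4; stub `stub_legKernelNormKernelPresentedLe`)

WHAT. The leg-weighted version of `kernelNorm_kernel_presented_le`
(`Literature/MathematicalPhysics/QuantumLattice/GrassmannKernelsPresented.lean`, unit weights): the
`m`-point kernel of the homogeneous Grassmann polynomial PRESENTED by `φ`,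
`Φ = Σ_Y φ(Y) ψ(Y_0)⋯ψ(Y_{m-1})` (`presented`), is the antisymmetrisation
`kernel Φ m X = (m!)⁻¹ Σ_σ sign σ · φ(X ∘ σ)` (`kernel_presented`), and its leg-weighted `L¹–L^∞` norm
(`legKernelNorm wt ε`, `Literature/MathematicalPhysics/QuantumLattice/HubbardScaleReport.lean`, §3) is
at most that of `φ`: `‖kernel Φ m‖_{wt,ε} ≤ ‖φ‖_{wt,ε}` for nonnegative leg weights `wt` and `ε ≥ 0` —
no factorial loss, the step converting positional estimates on presentations into estimates on
Salmhofer's kernels.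

HOW (the model proof, carrying the weight). Degree `0` is an equality (`Perm (Fin 0) = {1}`).
Degree `m + 1`: pointwise `‖kernel Φ X‖ ≤ ((m+1)!)⁻¹ Σ_σ ‖φ (X ∘ σ)‖` (`|sign σ| = 1`); multiplying by
the nonnegative weight `∏_q wt (X q)` and summing over the fibre `{X : X p = x}`, then exchanging the
two sums, each `σ`-term is a WEIGHTED pinned sum of `X ↦ φ (X ∘ σ)`, which — because the weight
`∏_q wt (X q)` is invariant under `X ↦ X ∘ σ` (`Equiv.prod_comp`) exactly like the counting measure —
is the weighted pinned sum of `φ` at leg `σ⁻¹ p` (`pinnedSum_comp_perm`), hence at most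
`‖φ‖_{wt,ε}` (`pinnedSum_le_legKernelNorm`); the `(m+1)!` equal terms cancel the prefactor, and
the norm of the kernel is at most any nonnegative bound of all its weighted pinned sums
(`legKernelNorm_succ_le_of_forall`).

SOURCES. M. Salmhofer, Commun. Math. Phys. 194 (1998) 249–295, §4.1 (the norm and its permutation
invariance) [`Salmhofer1998`]; M. Salmhofer, *Renormalization* (1999), §4.3 (4.95) (the
antisymmetrised kernel); the bookkeeping is folklore.

The file proves the generic lemmas over any `RCLike` scalar field and any finite label type in the
sub-namespace `LegKernelNormPresented` (weighted copies of `pinnedSum_le_kernelNorm`,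
`kernelNorm_succ_le_of_forall`, `pinnedSum_comp_perm` and `kernelNorm_kernel_presented_le` of
`GrassmannKernelsPresented.lean`), then the registered stub (scalars `ℂ`).
-/

set_option linter.dupNamespace false -- `Summit.<S>.<S>` doubles the summit name (tree convention)

namespace Summit.HubbardSuperconductivity.HubbardSuperconductivity.Theorems.AposterioriCapRgSeededBrokenRegimeBoseFermiPinned

open Literature.MathematicalPhysics.QuantumLattice GrassmannAlgebra

namespace LegKernelNormPresented

open Finset

variable {𝕜 : Type*} [RCLike 𝕜] {Γ : Type*} [Fintype Γ] [DecidableEq Γ]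

/-- Each weighted pinned sum is at most the leg-weighted norm (a value is at most a finite
supremum) — the weighted copy of `pinnedSum_le_kernelNorm`. [folklore] -/
theorem pinnedSum_le_legKernelNorm (wt : Γ → ℝ) (ε : ℝ) (m : ℕ) (K : (Fin (m + 1) → Γ) → 𝕜)
    (p : Fin (m + 1)) (x : Γ) :
    ε ^ m * ∑ X ∈ univ.filter (fun X : Fin (m + 1) → Γ => X p = x), (∏ q, wt (X q)) * ‖K X‖ ≤
      legKernelNorm wt ε (m + 1) K := by
  rw [legKernelNorm_succ]
  exact le_ciSup_of_le (Finite.bddAbove_range _) p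
    (le_ciSup_of_le (Finite.bddAbove_range _) x le_rfl)

/-- The leg-weighted norm in positive degree is at most `B ≥ 0` when every weighted pinned sum is
(for empty `Γ` the supremum is `0 ≤ B`) — the weighted copy of `kernelNorm_succ_le_of_forall`.
[folklore] -/
theorem legKernelNorm_succ_le_of_forall (wt : Γ → ℝ) (ε : ℝ) (m : ℕ) (K : (Fin (m + 1) → Γ) → 𝕜)
    {B : ℝ} (hB : 0 ≤ B)
    (h : ∀ (p : Fin (m + 1)) (x : Γ),
      ε ^ m * ∑ X ∈ univ.filter (fun X : Fin (m + 1) → Γ => X p = x), (∏ q, wt (X q)) * ‖K X‖ ≤ B) :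
    legKernelNorm wt ε (m + 1) K ≤ B := by
  rw [legKernelNorm_succ]
  rcases isEmpty_or_nonempty Γ with hΓ | hΓ
  · simp [hB]
  · exact ciSup_le fun p => ciSup_le fun x => h p x

omit [Fintype Γ] [DecidableEq Γ] in
/-- The leg weight `∏_q wt (X q)` is invariant under permutations of the legs, `X ↦ X ∘ σ`.
[folklore] -/
theorem prod_wt_comp_perm (wt : Γ → ℝ) {n : ℕ} (X : Fin n → Γ) (σ : Equiv.Perm (Fin n)) :
    ∏ q, wt (X (σ q)) = ∏ q, wt (X q) :=
  Equiv.prod_comp σ (fun q => wt (X q))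

/-- **Permutation invariance of the weighted pinned sums**: summing `(∏_q wt (X q)) ‖φ(X ∘ σ)‖` over
`X` with `X p` pinned is summing `(∏_q wt (Z q)) ‖φ(Z)‖` over `Z` with `Z (σ⁻¹ p)` pinned — the
weighted copy of `pinnedSum_comp_perm`. [folklore] -/
theorem pinnedSum_comp_perm (wt : Γ → ℝ) {m : ℕ} (φ : (Fin (m + 1) → Γ) → 𝕜)
    (σ : Equiv.Perm (Fin (m + 1))) (p : Fin (m + 1)) (x : Γ) :
    ∑ X ∈ univ.filter (fun X : Fin (m + 1) → Γ => X p = x), (∏ q, wt (X q)) * ‖φ (X ∘ σ)‖ =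
      ∑ Z ∈ univ.filter (fun Z : Fin (m + 1) → Γ => Z (σ.symm p) = x), (∏ q, wt (Z q)) * ‖φ Z‖ := by
  refine sum_nbij' (fun X => X ∘ σ) (fun Z => Z ∘ σ.symm) ?_ ?_ ?_ ?_ ?_
  · intro X hX
    refine mem_filter.2 ⟨mem_univ _, ?_⟩
    simpa using (mem_filter.1 hX).2
  · intro Z hZ
    refine mem_filter.2 ⟨mem_univ _, ?_⟩
    simpa using (mem_filter.1 hZ).2
  · intro X _; funext i; simp
  · intro Z _; funext i; simp
  · intro X _
    exact congrArg (· * ‖φ (X ∘ σ)‖) (prod_wt_comp_perm wt X σ).symm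

/-- **The leg-weighted norm of the kernel of a presented polynomial is at most that of its
presentation** (generic labels and scalars; no factorial loss: the `(m!)⁻¹` of the antisymmetrisation
compensates the `m!` permutations, each of which has the same weighted `L¹–L^∞` norm because the leg
weight `∏_q wt (X q)` is permutation invariant). [cite: Salmhofer1998, §4.1] -/
theorem legKernelNorm_kernel_presented_le {wt : Γ → ℝ} (hwt : ∀ Y, 0 ≤ wt Y) {ε : ℝ} (hε : 0 ≤ ε) :
    ∀ (m : ℕ) (φ : (Fin m → Γ) → 𝕜),
      legKernelNorm wt ε m (kernel 𝕜 (presented 𝕜 φ) m) ≤ legKernelNorm wt ε m φ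
  | 0, φ => by
    rw [legKernelNorm_zero_left, legKernelNorm_zero_left, kernel_presented]
    have h1 : (univ : Finset (Equiv.Perm (Fin 0))) = {1} := by
      ext σ; simp [Subsingleton.elim σ 1]
    rw [h1, sum_singleton, Equiv.Perm.sign_one, one_smul, Nat.factorial_zero, Nat.cast_one, inv_one,
      one_smul, one_mul]
    exact le_of_eq (congrArg _ (congrArg _ (funext fun i => i.elim0)))
  | m + 1, φ => by
    refine legKernelNorm_succ_le_of_forall wt ε m _ (legKernelNorm_nonneg hwt hε _ _) fun p x => ?_
    -- `‖kernel‖ ≤ (m+1)!⁻¹ Σ_σ ‖φ(X ∘ σ)‖`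
    have hpt : ∀ X : Fin (m + 1) → Γ, ‖kernel 𝕜 (presented 𝕜 φ) (m + 1) X‖ ≤
        ((m + 1).factorial : ℝ)⁻¹ * ∑ σ : Equiv.Perm (Fin (m + 1)), ‖φ (X ∘ σ)‖ := by
      intro X
      rw [kernel_presented, norm_mul]
      have hfac : ‖(((m + 1).factorial : ℚ)⁻¹ • (1 : 𝕜))‖ = ((m + 1).factorial : ℝ)⁻¹ := by
        rw [Rat.smul_one_eq_cast, Rat.cast_inv, Rat.cast_natCast, norm_inv, RCLike.norm_natCast]
      rw [hfac]
      refine mul_le_mul_of_nonneg_left ((norm_sum_le _ _).trans (sum_le_sum fun σ _ => le_of_eq ?_))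
        (by positivity)
      rw [Units.smul_def, norm_smul]
      rcases Int.units_eq_one_or (Equiv.Perm.sign σ) with h | h <;> simp [h]
    calc ε ^ m * ∑ X ∈ univ.filter (fun X : Fin (m + 1) → Γ => X p = x),
          (∏ q, wt (X q)) * ‖kernel 𝕜 (presented 𝕜 φ) (m + 1) X‖
        ≤ ε ^ m * ∑ X ∈ univ.filter (fun X : Fin (m + 1) → Γ => X p = x),
            (((m + 1).factorial : ℝ)⁻¹ * ∑ σ : Equiv.Perm (Fin (m + 1)),
              (∏ q, wt (X q)) * ‖φ (X ∘ σ)‖) :=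
          mul_le_mul_of_nonneg_left (sum_le_sum fun X _ =>
            (mul_le_mul_of_nonneg_left (hpt X) (prod_nonneg fun q _ => hwt _)).trans_eq
              (by rw [mul_left_comm, mul_sum])) (pow_nonneg hε m)
      _ = ((m + 1).factorial : ℝ)⁻¹ * ∑ σ : Equiv.Perm (Fin (m + 1)),
            (ε ^ m * ∑ Z ∈ univ.filter (fun Z : Fin (m + 1) → Γ => Z (σ.symm p) = x),
              (∏ q, wt (Z q)) * ‖φ Z‖) := by
          rw [← mul_sum, sum_comm, mul_left_comm, mul_sum]
          refine congrArg _ (sum_congr rfl fun σ _ => ?_)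
          rw [pinnedSum_comp_perm]
      _ ≤ ((m + 1).factorial : ℝ)⁻¹ * ∑ _σ : Equiv.Perm (Fin (m + 1)), legKernelNorm wt ε (m + 1) φ :=
          mul_le_mul_of_nonneg_left
            (sum_le_sum fun σ _ => pinnedSum_le_legKernelNorm wt ε m φ _ x)
            (by positivity)
      _ = legKernelNorm wt ε (m + 1) φ := by
          rw [sum_const, card_univ, Fintype.card_perm, Fintype.card_fin, nsmul_eq_mul, ← mul_assoc,
            inv_mul_cancel₀ (by positivity), one_mul]

end LegKernelNormPresented

/-! ### The registered stub -/

/-- **`stub_legKernelNormKernelPresentedLe`**: the leg-weighted `L¹–L^∞` norm of the (antisymmetrised)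
`m`-point kernel of the polynomial presented by `φ` is at most that of `φ`,
`‖kernel (Σ_Y φ(Y) ψ(Y)) m‖_{wt,ε} ≤ ‖φ‖_{wt,ε}`, for nonnegative leg weights and `ε ≥ 0` (complex
kernels, any finite label type). [cite: Salmhofer1998, §4.1] -/
theorem stub_legKernelNormKernelPresentedLe :
    ∀ {Γ : Type} [Fintype Γ] [DecidableEq Γ] (wt : Γ → ℝ), (∀ X, 0 ≤ wt X) → ∀ {ε : ℝ}, 0 ≤ ε →
      ∀ (m : ℕ) (φ : (Fin m → Γ) → ℂ),
        legKernelNorm wt ε m (kernel ℂ (presented ℂ φ) m) ≤ legKernelNorm wt ε m φ := by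
  intro Γ _ _ wt hwt ε hε m φ
  exact LegKernelNormPresented.legKernelNorm_kernel_presented_le hwt hε m φ

end Summit.HubbardSuperconductivity.HubbardSuperconductivity.Theorems.AposterioriCapRgSeededBrokenRegimeBoseFermiPinned
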